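import Summits.AtomisticToContinuum.HydrodynamicLimit.Theorems.OneFlightGossipEngineCollisionActivityTailsActivityDomination
import Literature.MathematicalPhysics.KineticTheory.ShortGapAiming
import Literature.Analysis.FluidPDE.HardSphereBusyParticles
import HarnessLib

/-!
# `CollisionActivityTails` (stmt-AtomisticToContinuum-13734), line `plaque-thinning-count-ld`, stub 2a:
own-birth thinning (`stub_ownBirthThinning : OwnBirthThinning`)

Helper file (`--supports stmt-AtomisticToContinuum-13734`) for the crux
`Summit.AtomisticToContinuum.HydrodynamicLimit.Theses.OneFlightGossipEngine.CollisionActivityTails`, line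
`plaque-thinning-count-ld`, registered stub `stub_ownBirthThinning : OwnBirthThinning` — the DETERMINISTIC, pathwise
part of stub 2: along one good hard-sphere orbit on `𝕋³` the number of collisions of particle `i` in the window
`(0, τℓ]`, `ℓ = (N+1)^{-1/3}`, is at most
`1 + τ/ϑ + #(aimed normal births over the pairs of i in (0, (τ+ϑ)ℓ]) + #(abnormal events relevant to i there)`.

The one-flight vocabulary (`G3, traj, AimsAt, IsAimedAt, IsNormalBirth, aimedBirths, collCount, pairsOf, abnormalCount`)
and the statement `OwnBirthThinning` are copied VERBATIM from the skeleton
`Cruxes/CollisionActivityTails/Lines/plaque_thinning_count_ld.lean` (§0–§1); the lead bridges definitionally.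

## Proof

The mathematics is the tree's `Literature.MathematicalPhysics.KineticTheory.ShortGapAiming` (pathwise kinematics and
bookkeeping of short gaps between two collisions of one sphere): `collCount` is the number of collision times of `i`
(`collisionSum_ite_fst_eq_card`, binary collisions); these times are thinned at scale `ϑℓ` (`card_le_thinning`: the long
gaps are `≤ τ/ϑ` in number, the next collision time being `nthCollisionTimeOf`); and every short gap `(s, e)`, `e − s < ϑℓ`,
is charged injectively (`card_shortGaps_le_sums`, from `slow_gap`: energy exit at `e`, the minimal image following the
pair free flight backward from the contact at `e` since `ε + 2uϑℓ ≤ ϱℓ < 1/4`, no re-contact of the outgoing pair) to a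
unit summand of `aimedBirths` (the shooter — `i`, or its next partner `q` at the last collision of `q` inside the gap —
has a NORMAL birth aimed at the other particle: `IsAimedAt`) or of `abnormalCount` (that birth is not normal; or some
post-collisional speed at `e` exceeds `u/2`, charged to the record `(q, i)` at `e`). This file only rewrites the three
counters as finite sums along the orbit (§2) and assembles (§3).
-/

noncomputable section

open MeasureTheory Set Filter Topology
open scoped ENNReal InnerProductSpace

namespace Summit.AtomisticToContinuum.HydrodynamicLimit.Theorems.CollisionActivityTailsOwnBirthThinning

open Literature.MathematicalPhysics.KineticTheory Literature.Analysis.FluidPDE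
open Summit.AtomisticToContinuum.HydrodynamicLimit.Theorems.CollisionActivityTailsActivityDomination
  (Flow Cfg window act tdist nearCount)

/-! ## §0 Vocabulary (verbatim from the skeleton `Lines/plaque_thinning_count_ld.lean`, §0) -/

variable {σ : ℝ} {N : ℕ}

/-- The torus geometry of `𝕋³` (shorthand). -/
abbrev G3 : Geometry (Fin 3) T3 := Torus.geometry (Fin 3)

/-- The orbit of the initial datum `z` under the flow `Φ`. -/
def traj (Φ : Flow σ N) (z : Cfg N) : ℝ → Cfg N := fun r => Φ.flow r z


/-! ### One-flight aiming vocabulary (grafted verbatim from the sibling skeleton `Lines/plaque_thinning_count_ld_b.lean`, §2) -/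

/-- The open ray `{s • v : s > 0}` from the origin passes within `ρ` of the point `d`:
`⟪d, v⟫ > 0` and `|d|²|v|² − ⟪d, v⟫² ≤ ρ²|v|²` (squared distance from `d` to the line `ℝ v`, times `|v|²`). -/
def AimsAt (d v : V3) (ρ : ℝ) : Prop :=
  0 < ⟪d, v⟫_ℝ ∧ ‖d‖ ^ 2 * ‖v‖ ^ 2 - ⟪d, v⟫_ℝ ^ 2 ≤ ρ ^ 2 * ‖v‖ ^ 2

/-- In the configuration `y` (read at a collision time of the shooter `k`: velocities are post-collisional), **`k` is
aimed at the target `j`** (catch radius `ϱ`, speed cap `u`, tolerance `2ε`): `j` is neither `k` nor `k`'s collision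
partner, lies within `ϱ` of `x_k`, has speed `≤ u`, and the velocity of `k` RELATIVE to `j` aims at `j`'s current centre
within `2ε` (so that, if nobody is deflected meanwhile, `k` hits `j`). -/
def IsAimedAt (ε ϱ u : ℝ) (y : Cfg N) (k j : Fin (N + 1)) : Prop :=
  j ≠ k ∧ j ≠ partner G3 ε y k ∧ tdist (y j).1 (y k).1 ≤ ϱ ∧ ‖(y j).2‖ ≤ u ∧
    AimsAt (G3.sepVec (y j).1 (y k).1) ((y k).2 - (y j).2) (2 * ε)

/-- **NORMAL BIRTH** of the shooter `k` at its collision time `t` along the orbit `γ` (the "long plaque, normal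
environment" valve of the growth lemma): post-collisional speeds of `k` and of its partner `≤ u`, relative speed
`≥ u / M₀` (non-gentle collision: the collision sphere of outgoing velocities is not degenerate), no third centre within
`3ε` of `x_k` (unshadowed partner disc), and a LONG INCOMING FLIGHT — `k` travelled at least `L₀ ε` since its previous
collision after time `0` (or since time `0`): expansion `1 + 2L/ε` of the one-flight unstable plaque. -/
def IsNormalBirth (ε u M₀ L₀ : ℝ) (γ : ℝ → Cfg N) (k : Fin (N + 1)) (t : ℝ) : Prop :=
  let y := γ t
  let j := partner G3 ε y k
  let c := HardSphereCollisionRecord.ofConfig G3 ε y t k j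
  ‖(y k).2‖ ≤ u ∧ ‖(y j).2‖ ≤ u ∧ u ≤ M₀ * ‖(y k).2 - (y j).2‖ ∧ nearCount y k (3 * ε) ≤ 2 ∧
    L₀ * ε ≤ ‖c.preVel.1‖ * (t - flightStart G3 ε γ 0 k t)

open scoped Classical in
/-- **Number of normal AIMED births** with times in `S`, over a set `P` of ordered (shooter, target) pairs: for each shooter
`k`, the number of its collision times in `S` that are normal births at which `k` is aimed at some `j` with `(k, j) ∈ P`
(a `finsum` over the collision times of `k`; junk `0` if there are infinitely many, a null event). -/
def aimedBirths (ε ϱ u M₀ L₀ : ℝ) (Φ : Flow σ N) (S : Set ℝ) (P : Finset (Fin (N + 1) × Fin (N + 1)))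
    (z : Cfg N) : ℝ :=
  ∑ k : Fin (N + 1), ∑ᶠ t ∈ collisionTimesOf G3 ε (traj Φ z) k ∩ S,
    if IsNormalBirth ε u M₀ L₀ (traj Φ z) k t ∧ ∃ j, (k, j) ∈ P ∧ IsAimedAt ε ϱ u (traj Φ z t) k j
    then (1 : ℝ) else 0

/-! ### Own-birth thinning vocabulary (lead, cycle 1: the deterministic part of stub 2) -/

/-- **Collision COUNT** of particle `i` over the times in `S` (as a real number): the number of ordered contact records of the orbit with
`c.fst = i` — each binary collision of `i` contributes exactly one such record (junk `0` off the good set). (Verbatim the sibling skeleton's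
`collCount`.) -/
def collCount (Φ : Flow σ N) (S : Set ℝ) (i : Fin (N + 1)) (z : Cfg N) : ℝ :=
  Φ.collisionSum S (fun c => if c.fst = i then (1 : ℝ) else 0) z

/-- The (shooter, target) pairs in which particle `i` takes part: `{i} × all ∪ all × {i}`. -/
def pairsOf (i : Fin (N + 1)) : Finset (Fin (N + 1) × Fin (N + 1)) :=
  (Finset.univ.image fun j => (i, j)) ∪ (Finset.univ.image fun j => (j, i))

open scoped Classical in
/-- **ABNORMAL events relevant to particle `i`** over the times in `S` (catch radius `ϱ`, speed cap `u`, valve parameters `M₀, L₀`): the number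
of ordered contact records `(k, l)` at collision times `t ∈ S` whose shooter `k` is within `ϱ` of `i` (this includes `k = i`) and whose birth is
NOT normal (`IsNormalBirth`), or near which (within `2ϱ` of `i`) some particle is faster than `u/2` (post-collisional speeds are read: if a
particle faster than `u` enters a collision, somebody leaves it faster than `u/√2 > u/2`, by energy conservation). These are the short flights of `i`
that own-birth thinning cannot charge to an aimed normal birth (`OwnBirthThinning`, case (iii)); they are priced by statics in stub 2. At a marked
time BOTH ordered records of the colliding pair near `i` count, which is what the charging of two consecutive flights to their common endpoint needs. -/
def abnormalCount (ε ϱ u M₀ L₀ : ℝ) (Φ : Flow σ N) (S : Set ℝ) (i : Fin (N + 1)) (z : Cfg N) : ℝ :=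
  Φ.collisionPairSum S (fun t cfg k _ =>
    if tdist (cfg k).1 (cfg i).1 ≤ ϱ ∧
        (¬ IsNormalBirth ε u M₀ L₀ (traj Φ z) k t ∨ ∃ m : Fin (N + 1), tdist (cfg m).1 (cfg i).1 ≤ 2 * ϱ ∧ u / 2 < ‖(cfg m).2‖)
    then (1 : ℝ) else 0) z

/-! ## §1 The statement (verbatim from the skeleton, §1) -/

/-- **STUB 2a — OWN-BIRTH THINNING (pathwise, deterministic; lead's reshape, cycle 1).** On the good set, for every particle `i`, window
`(0, τℓ]`, short-flight scale `ϑ > 0`, speed cap `u > 0` and catch radius `ϱℓ ≥ ε + 2uϑℓ` (and `N` so large that a wrap-around of the torus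
within time `ϑℓ` needs a speed `> u`: `4uϑℓ + 2ϱℓ < 1/2`): the number of collisions of `i` in the window is at most
`1 + τ/ϑ` (flights of `i` not shorter than `ϑℓ`: their durations sum to `≤ τℓ`) `+` the number of AIMED NORMAL BIRTHS over the pairs of `i` in
the enlarged window `(0, (τ+ϑ)ℓ]` `+` the number of ABNORMAL events relevant to `i` there. Mechanism: a flight of `i` shorter than `ϑℓ`, from its
birth `b` to the collision with `q`, is (i) an aimed normal birth of `(i, q)` at `b` (if `q` flew freely meanwhile: the fresh velocity of `i`
relative to `q` aims at `q` within `ε`), or (ii) an aimed normal birth of `(q, i)` at the last collision of `q` before it hits `i` (chains are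
this case iterated, each link paid at its own birth), or (iii) abnormal (the relevant birth is not normal, or a particle faster than `u` is
involved — the only way to exceed the catch radius or to wrap around); distinct short flights are charged to distinct birth events.
Size M/L (finite-set bookkeeping of collision times + free-flight kinematics on the torus + `IsHardSphereTrajectory` API); no probability. -/
def OwnBirthThinning : Prop :=
  ∀ (σ : ℝ) (N : ℕ) (Φ : Flow σ N) (z : Cfg N), z ∈ Φ.good → 0 < σ →
    ∀ (i : Fin (N + 1)) (τ ϑ ϱ u M₀ L₀ : ℝ), 0 < τ → 0 < ϑ → 0 < u →
    hsDiameter σ N + 2 * u * window ϑ N ≤ ϱ * ((N : ℝ) + 1) ^ (-(1 / 3 : ℝ)) →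
    4 * u * window ϑ N + 2 * (ϱ * ((N : ℝ) + 1) ^ (-(1 / 3 : ℝ))) < 2⁻¹ →
      collCount Φ (Set.Ioc 0 (window τ N)) i z ≤
        1 + τ / ϑ
          + aimedBirths (hsDiameter σ N) (ϱ * ((N : ℝ) + 1) ^ (-(1 / 3 : ℝ))) u M₀ L₀ Φ (Set.Ioc 0 (window (τ + ϑ) N)) (pairsOf i) z
          + abnormalCount (hsDiameter σ N) (ϱ * ((N : ℝ) + 1) ^ (-(1 / 3 : ℝ))) u M₀ L₀ Φ (Set.Ioc 0 (window (τ + ϑ) N)) i z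

/-! ## §2 The three counters as finite sums along the good orbit `orbit σ N Φ z = traj Φ z` -/

section Counting

variable {Φ : Flow σ N} {z : Cfg N}

/-- `traj Φ z` is the tree's `orbit σ N Φ z` (both are `fun t => Φ.flow t z`). -/
theorem traj_eq_orbit (Φ : Flow σ N) (z : Cfg N) : traj Φ z = orbit σ N Φ z := rfl

/-- Membership in `pairsOf i`: one of the two particles is `i`. -/
theorem mem_pairsOf {i k j : Fin (N + 1)} : (k, j) ∈ pairsOf i ↔ k = i ∨ j = i := by
  simp only [pairsOf, Finset.mem_union, Finset.mem_image, Finset.mem_univ, true_and, Prod.mk.injEq]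
  constructor
  · rintro (⟨_, rfl, rfl⟩ | ⟨_, rfl, rfl⟩)
    · exact Or.inl rfl
    · exact Or.inr rfl
  · rintro (rfl | rfl)
    · exact Or.inl ⟨j, rfl, rfl⟩
    · exact Or.inr ⟨k, rfl, rfl⟩

open scoped Classical in
/-- **The collision count is the number of collision times of `i`** in the window (binary collisions). -/
theorem collCount_eq_card (hz : z ∈ Φ.good) (hε2 : hsDiameter σ N < 2⁻¹) {S : Set ℝ}
    (hfin : (collisionTimes G3 (hsDiameter σ N) (orbit σ N Φ z) ∩ S).Finite) (i : Fin (N + 1)) :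
    collCount Φ S i z =
      ((hfin.toFinset.filter fun t => Participates G3 (hsDiameter σ N) (orbit σ N Φ z t) i).card : ℝ) :=
  collisionSum_ite_fst_eq_card (isTraj hz) (Torus.isHardSphereRegular_geometry hε2) hfin i

open scoped Classical in
/-- **`aimedBirths` as a finite sum** over (shooter, collision time in the window). -/
theorem aimedBirths_eq_sum (Φ : Flow σ N) (z : Cfg N) {S : Set ℝ}
    (hfin : (collisionTimes G3 (hsDiameter σ N) (orbit σ N Φ z) ∩ S).Finite) (ϱ u M₀ L₀ : ℝ)
    (P : Finset (Fin (N + 1) × Fin (N + 1))) :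
    aimedBirths (hsDiameter σ N) ϱ u M₀ L₀ Φ S P z =
      ∑ x ∈ Finset.univ ×ˢ hfin.toFinset,
        if Participates G3 (hsDiameter σ N) (orbit σ N Φ z x.2) x.1 then
          (if IsNormalBirth (hsDiameter σ N) u M₀ L₀ (orbit σ N Φ z) x.1 x.2 ∧
              ∃ j, (x.1, j) ∈ P ∧ IsAimedAt (hsDiameter σ N) ϱ u (orbit σ N Φ z x.2) x.1 j then (1 : ℝ) else 0)
        else 0 := by
  unfold aimedBirths
  rw [traj_eq_orbit, Finset.sum_product]
  refine Finset.sum_congr rfl fun k _ => ?_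
  rw [IsHardSphereTrajectory.collisionTimesOf_inter_eq_coe_filter hfin k, finsum_mem_coe_finset,
    Finset.sum_filter]

open scoped Classical in
/-- **`abnormalCount` as a finite sum** over the collision triples `(t, k, l)` of the window. -/
theorem abnormalCount_eq_sum (Φ : Flow σ N) (z : Cfg N) {S : Set ℝ}
    (hfin : (collisionTimes G3 (hsDiameter σ N) (orbit σ N Φ z) ∩ S).Finite) (ϱ u M₀ L₀ : ℝ)
    (i : Fin (N + 1)) :
    abnormalCount (hsDiameter σ N) ϱ u M₀ L₀ Φ S i z =
      ∑ x ∈ (finite_collisionTriples hfin).toFinset,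
        if tdist (orbit σ N Φ z x.1 x.2.1).1 (orbit σ N Φ z x.1 i).1 ≤ ϱ ∧
            (¬ IsNormalBirth (hsDiameter σ N) u M₀ L₀ (orbit σ N Φ z) x.2.1 x.1 ∨
              ∃ m : Fin (N + 1), tdist (orbit σ N Φ z x.1 m).1 (orbit σ N Φ z x.1 i).1 ≤ 2 * ϱ ∧
                u / 2 < ‖(orbit σ N Φ z x.1 m).2‖)
        then (1 : ℝ) else 0 := by
  unfold abnormalCount HardSphereFlow.collisionPairSum
  rw [traj_eq_orbit]
  change Literature.Analysis.FluidPDE.collisionPairSum G3 (hsDiameter σ N) (orbit σ N Φ z) S _ = _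
  rw [collisionPairSum_eq_finsum_triples hfin, finsum_mem_eq_finite_toFinset_sum]
  rfl

/-- `aimedBirths` is nonnegative. -/
theorem aimedBirths_nonneg (ε ϱ u M₀ L₀ : ℝ) (Φ : Flow σ N) (S : Set ℝ)
    (P : Finset (Fin (N + 1) × Fin (N + 1))) (z : Cfg N) : 0 ≤ aimedBirths ε ϱ u M₀ L₀ Φ S P z := by
  classical
  unfold aimedBirths
  refine Finset.sum_nonneg fun k _ => finsum_nonneg fun t => finsum_nonneg fun _ => ?_
  split_ifs <;> norm_num

/-- `abnormalCount` is nonnegative. -/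
theorem abnormalCount_nonneg (ε ϱ u M₀ L₀ : ℝ) (Φ : Flow σ N) (S : Set ℝ) (i : Fin (N + 1)) (z : Cfg N) :
    0 ≤ abnormalCount ε ϱ u M₀ L₀ Φ S i z := by
  classical
  unfold abnormalCount
  refine Summit.AtomisticToContinuum.HydrodynamicLimit.Theorems.CollisionActivityTailsActivityDomination.collisionPairSum_nonneg
    Φ _ (fun t y k l => ?_) z
  split_ifs <;> norm_num

/-- **The short gaps against the two counters.** A finite family `A` of collision times `s` of `i`, each with the next
collision time `nx s ∈ (s, s + δ)`, `nx s ≤ w` (`i` free in between), the spans ordered (`nx s₁ ≤ s₂` for `s₁ < s₂`),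
has `#A ≤ aimedBirths(pairsOf i) + abnormalCount(i)` over `(0, w + δ]` when `ε + 2uδ ≤ R` and `ε + 2uδ < 1/2`
(`card_shortGaps_le_sums` with the weights of the two counters). -/
theorem card_shortGaps_le (hz : z ∈ Φ.good) {u δ R w : ℝ} (hu : 0 < u) (hε : 0 < hsDiameter σ N)
    (hδ : 0 < δ) (hR : hsDiameter σ N + 2 * u * δ ≤ R) (hhalf : hsDiameter σ N + 2 * u * δ < 2⁻¹)
    (i : Fin (N + 1)) (M₀ L₀ : ℝ) (A : Finset ℝ) (nx : ℝ → ℝ)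
    (hA : ∀ s ∈ A, 0 < s ∧ s < nx s ∧ nx s ≤ w ∧ nx s - s < δ ∧
      Participates G3 (hsDiameter σ N) (orbit σ N Φ z s) i ∧
      Participates G3 (hsDiameter σ N) (orbit σ N Φ z (nx s)) i ∧
      ∀ t ∈ Ioo s (nx s), ¬ Participates G3 (hsDiameter σ N) (orbit σ N Φ z t) i)
    (hsep : ∀ s₁ ∈ A, ∀ s₂ ∈ A, s₁ < s₂ → nx s₁ ≤ s₂) :
    (A.card : ℝ) ≤ aimedBirths (hsDiameter σ N) R u M₀ L₀ Φ (Set.Ioc 0 (w + δ)) (pairsOf i) z +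
      abnormalCount (hsDiameter σ N) R u M₀ L₀ Φ (Set.Ioc 0 (w + δ)) i z := by
  classical
  have hfin : (collisionTimes G3 (hsDiameter σ N) (orbit σ N Φ z) ∩ Set.Ioc 0 (w + δ)).Finite :=
    (isTraj hz).finite_collisionTimes_inter_of_subset_Icc Set.Ioc_subset_Icc_self
  rw [aimedBirths_eq_sum Φ z hfin R u M₀ L₀ (pairsOf i), abnormalCount_eq_sum Φ z hfin R u M₀ L₀ i]
  refine card_shortGaps_le_sums hz hu hε hδ hR hhalf i
    (fun k t => IsNormalBirth (hsDiameter σ N) u M₀ L₀ (orbit σ N Φ z) k t) A nx hA hsep hfin _ _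
    (fun x => ?_) (fun x => ?_) (fun k t j hk hN hkj hAim => ?_) (fun t k m h1 h2 h3 => ?_)
    (fun t k l h1 h2 => ?_)
  · split_ifs <;> norm_num
  · split_ifs <;> norm_num
  · dsimp only
    rw [if_pos hk, if_pos ⟨hN, j, mem_pairsOf.2 hkj, hAim⟩]
  · exact if_pos ⟨h1, Or.inr ⟨m, h2, h3⟩⟩
  · exact if_pos ⟨h1, Or.inl h2⟩

end Counting

/-! ## §3 The stub -/

/-- **STUB 2a — own-birth thinning** (registered signature, verbatim): on the good set, the number of collisions of
`i` in `(0, τℓ]` is at most `1 + τ/ϑ + aimedBirths(pairsOf i) + abnormalCount(i)` over `(0, (τ+ϑ)ℓ]` (catch radius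
`ϱℓ ≥ ε + 2uϑℓ`, `4uϑℓ + 2ϱℓ < 1/2`). Proof: `collCount` = number of collision times of `i` (`collCount_eq_card`);
thinning of these times at scale `ϑℓ` (`card_le_thinning`, next collision time `nthCollisionTimeOf`); charging of the
short gaps (`card_shortGaps_le`). -/
theorem stub_ownBirthThinning : OwnBirthThinning := by
  intro σ N Φ z hz hσ i τ ϑ ϱ u M₀ L₀ hτ hϑ hu hR hhalf
  have hℓ : (0 : ℝ) < ((N : ℝ) + 1) ^ (-(1 / 3 : ℝ)) := Real.rpow_pos_of_pos (by positivity) _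
  have hδ : 0 < window ϑ N :=
    Summit.AtomisticToContinuum.HydrodynamicLimit.Theorems.CollisionActivityTailsActivityDomination.window_pos hϑ N
  have hw : 0 < window τ N :=
    Summit.AtomisticToContinuum.HydrodynamicLimit.Theorems.CollisionActivityTailsActivityDomination.window_pos hτ N
  have hε : 0 < hsDiameter σ N := by
    unfold hsDiameter
    push_cast
    exact mul_pos hσ hℓ
  have hwin : window (τ + ϑ) N = window τ N + window ϑ N := by unfold window; ring
  have hratio : window τ N / window ϑ N = τ / ϑ := by
    unfold window
    rw [mul_div_mul_right _ _ hℓ.ne']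
  rw [hwin]
  set δ := window ϑ N with hδdef
  set w := window τ N with hwdef
  set R := ϱ * ((N : ℝ) + 1) ^ (-(1 / 3 : ℝ)) with hRdef
  have huδ : 0 < u * δ := mul_pos hu hδ
  have hhalf' : hsDiameter σ N + 2 * u * δ < 2⁻¹ := by linarith
  have hε2 : hsDiameter σ N < 2⁻¹ := by linarith
  have hγ := isTraj hz
  have hfin : (collisionTimes G3 (hsDiameter σ N) (orbit σ N Φ z) ∩ Set.Ioc 0 w).Finite :=
    hγ.finite_collisionTimes_inter_of_subset_Icc Set.Ioc_subset_Icc_self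
  have hAB0 := aimedBirths_nonneg (hsDiameter σ N) R u M₀ L₀ Φ (Set.Ioc 0 (w + δ)) (pairsOf i) z
  have hAC0 := abnormalCount_nonneg (hsDiameter σ N) R u M₀ L₀ Φ (Set.Ioc 0 (w + δ)) i z
  have hτϑ : 0 ≤ τ / ϑ := div_nonneg hτ.le hϑ.le
  classical
  rw [collCount_eq_card hz hε2 hfin i]
  set F := hfin.toFinset.filter fun t => Participates G3 (hsDiameter σ N) (orbit σ N Φ z t) i with hFdef
  have hFmem : ∀ s ∈ F, s ∈ collisionTimesOf G3 (hsDiameter σ N) (orbit σ N Φ z) i ∧ 0 < s ∧ s ≤ w := by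
    intro s hs
    rw [hFdef, Finset.mem_filter, Set.Finite.mem_toFinset] at hs
    exact ⟨hs.2, hs.1.2.1, hs.1.2.2⟩
  have hFmem' : ∀ s, s ∈ collisionTimesOf G3 (hsDiameter σ N) (orbit σ N Φ z) i → 0 < s → s ≤ w → s ∈ F := by
    intro s h1 h2 h3
    rw [hFdef, Finset.mem_filter, Set.Finite.mem_toFinset]
    exact ⟨⟨collisionTimesOf_subset _ i h1, h2, h3⟩, h1⟩
  rcases F.eq_empty_or_nonempty with hF0 | hFne
  · rw [hF0, Finset.card_empty, Nat.cast_zero]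
    linarith
  -- the next collision time of `i`
  set nx : ℝ → ℝ := fun s => nthCollisionTimeOf G3 (hsDiameter σ N) (orbit σ N Φ z) s i 0 with hnxdef
  have hnx : ∀ s ∈ F, s ≠ F.max' hFne → nx s ∈ F ∧ s < nx s ∧ (∀ s' ∈ F, s < s' → nx s ≤ s') ∧
      ∀ t ∈ Ioo s (nx s), ¬ Participates G3 (hsDiameter σ N) (orbit σ N Φ z t) i := by
    intro s hs hne
    have hsM : s < F.max' hFne := lt_of_le_of_ne (F.le_max' s hs) hne
    have hne' : (collisionTimesOf G3 (hsDiameter σ N) (orbit σ N Φ z) i ∩ Ioi s).Nonempty :=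
      ⟨F.max' hFne, (hFmem _ (F.max'_mem hFne)).1, hsM⟩
    have hL := hγ.isLeast_nthCollisionTimeOf_zero hne'
    have hmin : ∀ t, t ∈ collisionTimesOf G3 (hsDiameter σ N) (orbit σ N Φ z) i → s < t → nx s ≤ t :=
      fun t ht hst => hL.2 ⟨ht, hst⟩
    have hsn : s < nx s := hL.1.2
    have hnM : nx s ≤ F.max' hFne := hmin _ (hFmem _ (F.max'_mem hFne)).1 hsM
    refine ⟨hFmem' _ hL.1.1 ((hFmem s hs).2.1.trans hsn) (hnM.trans (hFmem _ (F.max'_mem hFne)).2.2), hsn,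
      fun s' hs' hss' => hmin s' (hFmem s' hs').1 hss', fun t ht hpt => ?_⟩
    exact (not_le.2 ht.2) (hmin t hpt ht.1)
  have hthin := card_le_thinning F hFne nx hδ hw.le (fun s hs => (hFmem s hs).2)
    (fun s hs hne => ⟨(hnx s hs hne).2.1, (hnx s hs hne).2.2.1⟩)
  have hSG := card_shortGaps_le (w := w) hz hu hε hδ hR hhalf' i M₀ L₀
    ((F.erase (F.max' hFne)).filter fun s => nx s - s < δ) nx ?_ ?_
  · rw [hratio] at hthin
    linarith
  · intro s hs
    rw [Finset.mem_filter] at hs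
    obtain ⟨hs', hgap⟩ := hs
    have hsF : s ∈ F := Finset.mem_of_mem_erase hs'
    have hneM : s ≠ F.max' hFne := Finset.ne_of_mem_erase hs'
    obtain ⟨hnF, hsn, -, hfree⟩ := hnx s hsF hneM
    exact ⟨(hFmem s hsF).2.1, hsn, (hFmem _ hnF).2.2, hgap, (hFmem s hsF).1, (hFmem _ hnF).1, hfree⟩
  · intro s₁ hs₁ s₂ hs₂ hlt
    rw [Finset.mem_filter] at hs₁ hs₂
    exact (hnx s₁ (Finset.mem_of_mem_erase hs₁.1) (Finset.ne_of_mem_erase hs₁.1)).2.2.1 s₂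
      (Finset.mem_of_mem_erase hs₂.1) hlt

end Summit.AtomisticToContinuum.HydrodynamicLimit.Theorems.CollisionActivityTailsOwnBirthThinning
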